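import Mathlib
import Literature.Probability.LatticeModels.GKSInequalities
import Literature.Probability.LatticeModels.IsingInverseMCertificate
import Literature.Probability.LatticeModels.IsingInverseMCertificateSound
import Literature.Probability.LatticeModels.IsingInverseMCertificateSym
import Literature.Probability.LatticeModels.IsingInverseMCertificateAuto
import Literature.Probability.LatticeModels.IsingInverseMCertificateMulti
import Literature.Probability.LatticeModels.IsingInverseMCertificateMultiTwo
import HarnessLib

/-!
# Three-class inverse-M certificates (`IsingPolynomial.checkThree`, `checkThreeAuto`)

Level three of the multi-class certificate format of `IsingInverseMCertificateMulti`: the edges of a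
finite graph `(Fin n, E)` fall into the class-`0` edges (coupling `K₀`), the class-`1` edges
(coupling `K₁`) and all the others (coupling `K₂`), and a certificate proves `(Σ⁻¹)_{xy} ≤ 0`
(`x ≠ y`) for the zero-field Ising model for ALL `K₀, K₁, K₂ ≥ 0` at once — e.g. the three direction
classes of a box in `ℤ³`, the inverse-M question of Lauritzen–Uhler–Zwiernik (2021, §5) with fully
anisotropic couplings. [cite: LauritzenUhlerZwiernik2021, §5]

Trivariate integer polynomials in `v_c = e^{2K_c} − 1` are nested coefficient lists
`List (List (List ℤ))` (outer index = power of `v₂`), operations `o3 = o2.up`, evaluation `ev3`.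
Contents, parallel to `IsingInverseMCertificateMultiTwo`: the enumeration `entry3` with its
correctness `ev3_entry3`; the explicit-data checker `checkThree`; the self-computing checker
`checkThreeAuto` (Montante elimination on the grid `{0..n·m₀} × {0..n·m₁} × {0..n·m₂}`, exact
interpolation one variable at a time; unproved, re-verified by `checkCoreG o3`); soundness
`inv_entry_nonpos_of_checkThree` / `inv_entry_nonpos_of_checkThreeAuto`. [cite: FriedliVelenik2017, §3.8.1]
-/

/-! ### Three coupling classes: trivariate polynomials as `List (List (List ℤ))` (outer index = power of `v₂`) -/

namespace Literature.Probability.LatticeModels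

namespace IsingPolynomial

open Finset Matrix

/-- Operations on trivariate integer polynomials `List (List (List ℤ))`. [folklore] -/
def o3 : LOps (List (List (List ℤ))) := o2.up

/-- Evaluation of `List (List (List ℤ))` at `(v₀, v₁, v₂)`. [folklore] -/
def ev3 (v0 v1 v2 : ℝ) (P : List (List (List ℤ))) : ℝ := geval (ev2 v0 v1) P v2

/-- `ev3` is sound for `o3` on the nonnegative octant. [folklore] -/
theorem sem3 {v0 v1 v2 : ℝ} (h0 : 0 ≤ v0) (h1 : 0 ≤ v1) (h2 : 0 ≤ v2) : o3.Sem (ev3 v0 v1 v2) :=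
  LOps.up_sem (sem2 h0 h1) v2 h2

/-! ### Enumeration of the trivariate Edwards–Sokal rows -/

/-- (`#` satisfied class-`0` edges, `#` satisfied class-`1` edges, `#` satisfied other edges) of the
configuration coded by `k`. [folklore] -/
def satTriple (k : ℕ) : List (ℕ × ℕ) → List ℕ → ℕ × ℕ × ℕ
  | [], _ => (0, 0, 0)
  | e :: es, cls =>
    let r := satTriple k es cls.tail
    if bit k e.1 = bit k e.2 then
      (if cls.headD 0 = 0 then (r.1 + 1, r.2.1, r.2.2)
       else if cls.headD 0 = 1 then (r.1, r.2.1 + 1, r.2.2) else (r.1, r.2.1, r.2.2 + 1))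
    else r

/-- Nested coefficients of `a · (1+v₀)^{s₀} (1+v₁)^{s₁} (1+v₂)^{s₂}`. [folklore] -/
def binom3 (a : ℤ) (s0 s1 s2 : ℕ) : List (List (List ℤ)) :=
  (onePlusPow s2).map fun c => binom2 (a * c) s0 s1

/-- The contribution of configuration `k` to `M_{pq}(v₀, v₁, v₂)`. [folklore] -/
def term3 (E : List (ℕ × ℕ)) (cls : List ℕ) (p q k : ℕ) : List (List (List ℤ)) :=
  let s := satTriple k E cls
  binom3 (spinOf k p * spinOf k q) s.1 s.2.1 s.2.2

/-- `∑_{j < 2^d} f (2^d k + j)`, binary splitting. [folklore] -/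
def cfgSum3 (f : ℕ → List (List (List ℤ))) : ℕ → ℕ → List (List (List ℤ))
  | 0, k => f k
  | d + 1, k => gadd o2 (cfgSum3 f d (2 * k)) (cfgSum3 f d (2 * k + 1))

/-- The trivariate Edwards–Sokal entry
`M_{pq}(v) = ∑_ω σ_pσ_q (1+v₀)^{sat₀(ω)} (1+v₁)^{sat₁(ω)} (1+v₂)^{sat₂(ω)}`. [folklore] -/
def entry3 (n : ℕ) (E : List (ℕ × ℕ)) (cls : List ℕ) (p q : ℕ) : List (List (List ℤ)) :=
  cfgSum3 (term3 E cls p q) n 0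

/-- The three-class checker with explicit data: the rows `rows` of `Mtab` are re-derived by
enumeration, then the generic core checker at level three. [folklore] -/
def checkThree (n : ℕ) (E : List (ℕ × ℕ)) (cls : List ℕ) (Mtab : List (List (List (List (List ℤ)))))
    (Bcls : List (List (List (List ℤ)))) (Bidx : List (List ℕ)) (d : List (List (List ℤ)))
    (rows : List ℕ) (gens : List (List ℕ × List ℕ)) : Bool :=
  (rows.all fun p => (List.range n).all fun q => o3.eqv (getPolyG o3 Mtab p q) (entry3 n E cls p q)) &&
  checkCoreG o3 n E cls Mtab Bcls Bidx d rows gens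

section Semantics3

variable {n : ℕ}

/-- `binom3 a s₀ s₁ s₂` evaluates to `a (1+v₀)^{s₀} (1+v₁)^{s₁} (1+v₂)^{s₂}`. [folklore] -/
theorem ev3_binom3 (v0 v1 v2 : ℝ) (a : ℤ) (s0 s1 s2 : ℕ) :
    ev3 v0 v1 v2 (binom3 a s0 s1 s2) = (a : ℝ) * (1 + v0) ^ s0 * (1 + v1) ^ s1 * (1 + v2) ^ s2 := by
  rw [ev3, binom3, geval_map_const_mul (ev2 v0 v1) _ ((a : ℝ) * (1 + v0) ^ s0 * (1 + v1) ^ s1)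
    (fun c => by rw [ev2_binom2, Int.cast_mul]; ring), leval_onePlusPow]

/-- `cfgSum3` evaluates to the sum of the evaluations. [folklore] -/
theorem ev3_cfgSum3 {v0 v1 : ℝ} (h0 : 0 ≤ v0) (h1 : 0 ≤ v1) (v2 : ℝ) (f : ℕ → List (List (List ℤ)))
    (d k : ℕ) :
    ev3 v0 v1 v2 (cfgSum3 f d k) = ∑ j ∈ Finset.range (2 ^ d), ev3 v0 v1 v2 (f (2 ^ d * k + j)) := by
  induction d generalizing k with
  | zero => simp [cfgSum3]
  | succ d ih =>
    rw [cfgSum3, ev3, geval_gadd (sem2 h0 h1), ← ev3, ← ev3, ih, ih]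
    have h2 : 2 ^ (d + 1) = 2 ^ d + 2 ^ d := by ring
    rw [h2, Finset.sum_range_add]
    congr 1
    · exact Finset.sum_congr rfl fun j _ => by
        rw [show 2 ^ d * (2 * k) + j = (2 ^ d + 2 ^ d) * k + j by ring]
    · exact Finset.sum_congr rfl fun j _ => by
        rw [show 2 ^ d * (2 * k + 1) + j = (2 ^ d + 2 ^ d) * k + (2 ^ d + j) by ring]

/-- The three satisfied-edge counts of a genuine configuration. [folklore] -/
def satTripleR (ω : SpinConfig (Fin n)) : List (ℕ × ℕ) → List ℕ → ℕ × ℕ × ℕ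
  | [], _ => (0, 0, 0)
  | e :: es, cls =>
    let r := satTripleR ω es cls.tail
    if spinN ω e.1 = spinN ω e.2 then
      (if cls.headD 0 = 0 then (r.1 + 1, r.2.1, r.2.2)
       else if cls.headD 0 = 1 then (r.1, r.2.1 + 1, r.2.2) else (r.1, r.2.1, r.2.2 + 1))
    else r

/-- On a decoded configuration the two triple counts agree. [folklore] -/
theorem satTripleR_cfgEquiv_symm (k : Fin (2 ^ n)) :
    ∀ (l : List (ℕ × ℕ)) (cls : List ℕ), (∀ e ∈ l, e.1 < n ∧ e.2 < n) →
      satTripleR ((cfgEquiv n).symm k) l cls = satTriple k l cls := by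
  intro l
  induction l with
  | nil => intro cls _; rfl
  | cons e es ih =>
    intro cls hl
    have he := hl e (by simp)
    have ih' := ih cls.tail fun e' he' => hl e' (by simp [he'])
    simp only [satTripleR, satTriple, ih']
    by_cases h : bit k e.1 = bit k e.2
    · rw [if_pos ((spinN_eq_iff_bit k he.1 he.2).2 h), if_pos h]
    · rw [if_neg (mt (spinN_eq_iff_bit k he.1 he.2).1 h), if_neg h]

/-- The product of the three-class Edwards–Sokal factors along an edge list (indexed by `range`). [folklore] -/
theorem prod_range_factor3_eq (ω : SpinConfig (Fin n)) (v0 v1 v2 : ℝ) :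
    ∀ (l : List (ℕ × ℕ)) (cls : List ℕ),
      ∏ i ∈ Finset.range l.length, (if spinN ω (l.getD i (0, 0)).1 = spinN ω (l.getD i (0, 0)).2
        then 1 + (if cls.getD i 0 = 0 then v0 else if cls.getD i 0 = 1 then v1 else v2)
        else (1 : ℝ)) =
      (1 + v0) ^ (satTripleR ω l cls).1 * (1 + v1) ^ (satTripleR ω l cls).2.1 *
        (1 + v2) ^ (satTripleR ω l cls).2.2 := by
  intro l
  induction l with
  | nil => intro cls; simp [satTripleR]
  | cons e es ih =>
    intro cls
    rw [List.length_cons, Finset.prod_range_succ']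
    simp only [List.getD_cons_succ, List.getD_cons_zero, getD_succ_eq_tail, getD_zero_eq_headD]
    rw [ih cls.tail]
    simp only [satTripleR]
    split_ifs <;> ring

/-- The same product indexed by `Fin E.length`, as in `esTrue`. [folklore] -/
theorem prod_factor3_eq (ω : SpinConfig (Fin n)) (v0 v1 v2 : ℝ) (l : List (ℕ × ℕ)) (cls : List ℕ) :
    ∏ i : Fin l.length, (if spinN ω (l[i.1]).1 = spinN ω (l[i.1]).2
        then 1 + (if cls.getD i.1 0 = 0 then v0 else if cls.getD i.1 0 = 1 then v1 else v2)
        else (1 : ℝ)) =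
      (1 + v0) ^ (satTripleR ω l cls).1 * (1 + v1) ^ (satTripleR ω l cls).2.1 *
        (1 + v2) ^ (satTripleR ω l cls).2.2 := by
  rw [← prod_range_factor3_eq ω v0 v1 v2 l cls, ← Fin.prod_univ_eq_prod_range]
  refine Finset.prod_congr rfl fun i _ => ?_
  rw [List.getD_eq_getElem _ _ i.2]

/-- Evaluation of one configuration term. [folklore] -/
theorem ev3_term3 (v0 v1 v2 : ℝ) (E : List (ℕ × ℕ)) (cls : List ℕ) (p q k : ℕ) :
    ev3 v0 v1 v2 (term3 E cls p q k) =
      ((spinOf k p * spinOf k q : ℤ) : ℝ) * (1 + v0) ^ (satTriple k E cls).1 *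
        (1 + v1) ^ (satTriple k E cls).2.1 * (1 + v2) ^ (satTriple k E cls).2.2 := by
  rw [term3, ev3_binom3]

/-- **The trivariate enumeration is correct**: `entry3` evaluates to the true three-class
Edwards–Sokal entry (class `0` ↦ `v₀`, class `1` ↦ `v₁`, every other class ↦ `v₂`). [folklore] -/
theorem ev3_entry3 {E : List (ℕ × ℕ)} (hE : edgesOK n E = true) (cls : List ℕ) {v0 v1 : ℝ}
    (h0 : 0 ≤ v0) (h1 : 0 ≤ v1) (v2 : ℝ) (p q : Fin n) :
    ev3 v0 v1 v2 (entry3 n E cls p q) =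
      esTrue n E cls (fun c => if c = 0 then v0 else if c = 1 then v1 else v2) p q := by
  simp only [esTrue, prod_factor3_eq _ v0 v1 v2 E cls]
  rw [← Equiv.sum_comp (cfgEquiv n).symm, entry3, ev3_cfgSum3 h0 h1]
  simp only [mul_zero, zero_add]
  rw [← Fin.sum_univ_eq_sum_range (fun k => ev3 v0 v1 v2 (term3 E cls p q k)) (2 ^ n)]
  refine Finset.sum_congr rfl fun k _ => ?_
  rw [ev3_term3, satTripleR_cfgEquiv_symm k E cls (edgesOK_mem hE), spinAt, spinAt,
    coe_cfgEquiv_symm, coe_cfgEquiv_symm]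
  push_cast
  ring

end Semantics3

/-! ### Soundness of the three-class checkers -/

section Sound3

variable {n : ℕ} {E : List (ℕ × ℕ)} {cls : List ℕ}

/-- **Soundness at level three, core form**: `checkCoreG o3` on a table whose rows `rows` evaluate
like `entry3` proves `(Σ⁻¹)_{xy} ≤ 0` for every `K₀, K₁, K₂ ≥ 0` (class `0` edges carry `K₀`,
class `1` edges `K₁`, all other edges `K₂`). [folklore] -/
theorem inv_entry_nonpos_of_core3 {Mtab : List (List (List (List (List ℤ))))}
    {Bcls : List (List (List (List ℤ)))} {Bidx : List (List ℕ)} {d : List (List (List ℤ))}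
    {rows : List ℕ} {gens : List (List ℕ × List ℕ)}
    (hcore : checkCoreG o3 n E cls Mtab Bcls Bidx d rows gens = true)
    (hM : ∀ p ∈ rows, p < n → ∀ q < n, ∀ v0 v1 v2 : ℝ, 0 ≤ v0 → 0 ≤ v1 →
      ev3 v0 v1 v2 (getPolyG o3 Mtab p q) = ev3 v0 v1 v2 (entry3 n E cls p q))
    (K0 K1 K2 : ℝ) (hK0 : 0 ≤ K0) (hK1 : 0 ≤ K1) (hK2 : 0 ≤ K2) (x y : Fin n) (hxy : x ≠ y) :
    (Matrix.of fun p q : Fin n => gksExpect Finset.univ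
        (fun i : Fin E.length =>
          if cls.getD i.1 0 = 0 then K0 else if cls.getD i.1 0 = 1 then K1 else K2)
        (edgeSet n E) (fun ω => spinAt p ω * spinAt q ω))⁻¹ x y ≤ 0 := by
  set v0 : ℝ := Real.exp (2 * K0) - 1 with hv0_def
  set v1 : ℝ := Real.exp (2 * K1) - 1 with hv1_def
  set v2 : ℝ := Real.exp (2 * K2) - 1 with hv2_def
  have hv0 : 0 ≤ v0 := sub_nonneg.2 (Real.one_le_exp (by linarith))
  have hv1 : 0 ≤ v1 := sub_nonneg.2 (Real.one_le_exp (by linarith))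
  have hv2 : 0 ≤ v2 := sub_nonneg.2 (Real.one_le_exp (by linarith))
  have hE := edgesOK_of_checkCoreG hcore
  have hfun : (fun c : ℕ => Real.exp (2 * (if c = 0 then K0 else if c = 1 then K1 else K2)) - 1) =
      fun c => if c = 0 then v0 else if c = 1 then v1 else v2 := by
    funext c
    split_ifs <;> rfl
  have key := inv_entry_nonpos_of_checkCoreG (sem3 hv0 hv1 hv2) hcore
    (fun c => if c = 0 then K0 else if c = 1 then K1 else K2)
    (fun p hp hpn q => by
      rw [hfun, hM p hp hpn q q.2 v0 v1 v2 hv0 hv1]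
      exact ev3_entry3 hE cls hv0 hv1 v2 ⟨p, hpn⟩ q) x y hxy
  exact key

/-- **Soundness of `checkThree`.** [folklore] -/
theorem inv_entry_nonpos_of_checkThree {Mtab : List (List (List (List (List ℤ))))}
    {Bcls : List (List (List (List ℤ)))} {Bidx : List (List ℕ)} {d : List (List (List ℤ))}
    {rows : List ℕ} {gens : List (List ℕ × List ℕ)}
    (h : checkThree n E cls Mtab Bcls Bidx d rows gens = true)
    (K0 K1 K2 : ℝ) (hK0 : 0 ≤ K0) (hK1 : 0 ≤ K1) (hK2 : 0 ≤ K2) (x y : Fin n) (hxy : x ≠ y) :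
    (Matrix.of fun p q : Fin n => gksExpect Finset.univ
        (fun i : Fin E.length =>
          if cls.getD i.1 0 = 0 then K0 else if cls.getD i.1 0 = 1 then K1 else K2)
        (edgeSet n E) (fun ω => spinAt p ω * spinAt q ω))⁻¹ x y ≤ 0 := by
  simp only [checkThree, Bool.and_eq_true] at h
  obtain ⟨hM, hcore⟩ := h
  refine inv_entry_nonpos_of_core3 hcore (fun p hp _ q hq v0 v1 v2 hv0 hv1 => ?_) K0 K1 K2 hK0 hK1
    hK2 x y hxy
  exact geval_eq_of_gEq (sem2 hv0 hv1) v2 (all_range (List.all_eq_true.1 hM p hp) hq)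

end Sound3

/-! ### Self-computed three-class certificates (for `native_decide`) -/

/-- Evaluate a trivariate integer polynomial at an integer point. [folklore] -/
def leval3Int (f : List (List (List ℤ))) (x0 x1 x2 : ℤ) : ℤ := leval (f.map fun c => leval2Int c x0 x1) x2

/-- Drop trailing empty entries of a trivariate coefficient array. [folklore] -/
def otrim3 (P : List (List (List ℤ))) : List (List (List ℤ)) :=
  (P.reverse.dropWhile fun l => l.isEmpty).reverse

/-- Exact trivariate interpolation on the grid `{0..N₀} × {0..N₁} × {0..N₂}`: from the values
`vals[x₂][x₁][x₀]`, the nested coefficients (outer index = power of `v₂`): `interp2` for each `x₂`,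
then coefficientwise in `v₂`. [folklore] -/
def interp3 (vals : List (List (List ℤ))) : List (List (List ℤ)) :=
  let P := vals.map interp2
  let lb := P.foldl (fun m l => max m l.length) 0
  let la := P.foldl (fun m l => max m (l.foldl (fun m' r => max m' r.length) 0)) 0
  let Q : List (List (List ℤ)) := (List.range lb).map fun b => (List.range la).map fun a =>
    interpolate0N (P.map fun l => (l.getD b []).getD a 0)
  let lc := Q.foldl (fun m row => max m (row.foldl (fun m' l => max m' l.length) 0)) 0
  otrim3 ((List.range lc).map fun c =>
    otrim ((List.range lb).map fun b => ltrim ((List.range la).map fun a =>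
      ((Q.getD b []).getD a []).getD c 0)))

/-- The number of class-`1` edges among the first `m`. [folklore] -/
def numClass1 (cls : List ℕ) (m : ℕ) : ℕ := ((List.range m).filter fun i => cls.getD i 0 = 1).length

/-- Compute the rest of the level-three certificate `(Bcls, Bidx, d)` from the row table and the
coset data, on the grid `{0..n·m₀} × {0..n·m₁} × {0..n·m₂}`. Nothing about it is proved. [folklore] -/
def autoCert3 (n : ℕ) (E : List (ℕ × ℕ)) (cls : List ℕ) (rows : List ℕ) (coset : List (ℕ × List ℕ))
    (Mtab : List (List (List (List (List ℤ))))) :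
    List (List (List (List ℤ))) × List (List ℕ) × List (List (List ℤ)) :=
  let m0 := numClass0 cls E.length
  let m1 := numClass1 cls E.length
  let N0 := n * m0
  let N1 := n * m1
  let N2 := n * (E.length - m0 - m1)
  let rowPolys : List (List (List (List (List ℤ)))) := rows.map fun r => Mtab.getD r []
  let Mpoly : List (List (List (List (List ℤ)))) := (List.range n).map fun p =>
    let c := coset.getD p (0, [])
    (List.range n).map fun q => (rowPolys.getD c.1 []).getD (permAt c.2 q) []
  let evals : List (List (List (ℤ × List (List ℤ)))) := (List.range (N2 + 1)).map fun x2 =>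
    (List.range (N1 + 1)).map fun x1 => (List.range (N0 + 1)).map fun x0 =>
      detAdjCols n (Mpoly.map fun row => row.map fun f => leval3Int f x0 x1 x2) rows
  let d := interp3 (evals.map fun pl => pl.map fun col => col.map fun e => e.1)
  let Bcls : List (List (List (List ℤ))) := (List.range rows.length).flatMap fun j =>
    (List.range n).map fun i =>
      interp3 (evals.map fun pl => pl.map fun col => col.map fun e => (e.2.getD j []).getD i 0)
  let Bidx : List (List ℕ) := (List.range n).map fun p =>
    let c := coset.getD p (0, [])
    (List.range n).map fun q => c.1 * n + permAt c.2 q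
  (Bcls, Bidx, d)

/-- The table of rows `rows` of the trivariate Edwards–Sokal matrix (other rows empty). [folklore] -/
def rowTable3 (n : ℕ) (E : List (ℕ × ℕ)) (cls : List ℕ) (rows : List ℕ) :
    List (List (List (List (List ℤ)))) :=
  (List.range n).map fun p => if p ∈ rows then (List.range n).map fun q => entry3 n E cls p q else []

/-- **The self-computing three-class checker.** [folklore] -/
def checkThreeAuto (n : ℕ) (E : List (ℕ × ℕ)) (cls : List ℕ) (rows : List ℕ)
    (gens : List (List ℕ × List ℕ)) (coset : List (ℕ × List ℕ)) : Bool :=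
  let Mtab := rowTable3 n E cls rows
  let c := autoCert3 n E cls rows coset Mtab
  checkCoreG o3 n E cls Mtab c.1 c.2.1 c.2.2 rows gens

/-- The rows of `rowTable3` are the enumerated rows. [folklore] -/
theorem getPolyG_rowTable3 {n : ℕ} {E : List (ℕ × ℕ)} {cls : List ℕ} {rows : List ℕ} {p q : ℕ}
    (hp : p ∈ rows) (hpn : p < n) (hq : q < n) :
    getPolyG o3 (rowTable3 n E cls rows) p q = entry3 n E cls p q := by
  have h1 : (rowTable3 n E cls rows).getD p [] = (List.range n).map fun q => entry3 n E cls p q := by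
    rw [rowTable3, List.getD_eq_getElem _ _ (by simpa using hpn)]
    simp [hp]
  rw [getPolyG, h1, List.getD_eq_getElem _ _ (by simpa using hq)]
  simp

/-- **Soundness of `checkThreeAuto`.** For the zero-field Ising model on `(Fin n, E)` with coupling
`K₀ ≥ 0` on the class-`0` edges, `K₁ ≥ 0` on the class-`1` edges and `K₂ ≥ 0` on all other edges,
every off-diagonal entry of the inverse of the spin second-moment matrix is `≤ 0`. [folklore] -/
theorem inv_entry_nonpos_of_checkThreeAuto {n : ℕ} {E : List (ℕ × ℕ)} {cls : List ℕ} {rows : List ℕ}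
    {gens : List (List ℕ × List ℕ)} {coset : List (ℕ × List ℕ)}
    (h : checkThreeAuto n E cls rows gens coset = true) (K0 K1 K2 : ℝ) (hK0 : 0 ≤ K0) (hK1 : 0 ≤ K1)
    (hK2 : 0 ≤ K2) (x y : Fin n) (hxy : x ≠ y) :
    (Matrix.of fun p q : Fin n => gksExpect Finset.univ
        (fun i : Fin E.length =>
          if cls.getD i.1 0 = 0 then K0 else if cls.getD i.1 0 = 1 then K1 else K2)
        (edgeSet n E) (fun ω => spinAt p ω * spinAt q ω))⁻¹ x y ≤ 0 :=
  inv_entry_nonpos_of_core3 (Mtab := rowTable3 n E cls rows)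
    (Bcls := (autoCert3 n E cls rows coset (rowTable3 n E cls rows)).1)
    (Bidx := (autoCert3 n E cls rows coset (rowTable3 n E cls rows)).2.1)
    (d := (autoCert3 n E cls rows coset (rowTable3 n E cls rows)).2.2) h
    (fun _ hp hpn _ hq v0 v1 v2 _ _ => by rw [getPolyG_rowTable3 hp hpn hq]) K0 K1 K2 hK0 hK1 hK2 x y
    hxy

end IsingPolynomial

end Literature.Probability.LatticeModels
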